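import Literature.Computability.AlgebraicComplexity.LevelDescent
import Literature.Computability.AlgebraicComplexity.LevelTriples
import Literature.Computability.AlgebraicComplexity.GlobalStageStructure
import HarnessLib

/-!
# The data of the constituent stage: level-`(ℓ−1)` block triples inside a level-`ℓ` interface tensor,
their pair term map, the tensor `𝒯*` and the holes of the first type
(Vassilevska Williams–Xu–Xu–Zhou 2024, §6.2–§6.6, definitions) — proved

Topic `Literature/Computability/AlgebraicComplexity`.  The constituent stage (§6 of Vassilevska
Williams–Xu–Xu–Zhou, *New bounds for matrix multiplication: from alpha to omega*, SODA 2024,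
arXiv:2307.07970) hashes level-`(ℓ−1)` block triples INSIDE a level-`ℓ` `ε`-interface tensor
`𝒯 = 𝒯_{τ,L,ε}` (chunks of `c + c` positions).  Read on the half-chunks (`LevelDescent.lean`: a variable
`x' : Fin (n+n) → Fin c → Fin (q+2)`, position `u < n` = left half of chunk `u`, position `n + u` = its right
half) a level-`(ℓ−1)` block triple is a triple of sequences `Fin (n+n) → Fin (2c+1)` — the format of the
global stage (`GlobalStageStructure.lean`) with `N = n + n` — and this file sets up its §6 vocabulary:

* `chunkOf`, `halfTermOf` — the chunk and the level-`ℓ` term of a half-chunk position;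
* `InsideX/Y/Z` — a level-`(ℓ−1)` block lies inside the level-`ℓ` blocks of the parameter list
  (`I(left u) + I(right u) = i_{τu}`), automatic for the blocks of supported variables of `𝒯`
  (`insideX_of_mem_levelBlocksX`, from `patternLevel_eq_add`);
* `pairTermMap`, `pairTermIdx`, `pairClass` — **the term map of `𝒯*`**: half-chunk position
  `p ↦ (t(p), (I_p, J_p, K_p))`, the level-`ℓ` term refined by the level-`(ℓ−1)` constituent triple
  (§6.3: the classes `S_{t,i',j',k'} = {p in the t-th term | I_p = i', J_p = j', K_p = k'}`), with
  `filter_pairTermIdx_eq` (its fibres are the classes);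
* `pairTermList`, `starTensor₂` — **`𝒯* = ⊗_t ⊗_{i'+j'+k'=2^{ℓ−1}} T_{i',j',k'}^{⊗|S_{t,i',j',k'}|}[β_{X,t,i'j'k'}, β_{Y,…}, β_{Z,…}]`**
  (§6.5), the exact level-`(ℓ−1)` interface tensor with the pair term map and the level-`(ℓ−1)`
  split distributions `β_{W,t,i',j',k'}`;
* `leftClass`, `card_pairClass_eq` — the left positions of split type `(i',j',k')` in term `t`;
  for a triple inside the level-`ℓ` blocks, **`|S_{t,i',j',k'}| = #left(t,(i',j',k')) + #left(t,(i_t−i',j_t−j',k_t−k'))`**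
  (§6.6: "`A_{t,1}(α_t(i',j',k') + α_t(i_t−i',…)) n_t` level-(ℓ−1) positions corresponding to
  `(i',j',k')`, and among them `A_{t,1} α_t(i',j',k') n_t` are in odd positions");
* `mergeSeq`, `levelSeq_mergeHalves`, `firstTypeHolesX` — **the holes of the first type**: level-1
  `X`-blocks of `𝒯*` whose merged level-1 sequence is not `ε`-admissible for the input `𝒯`
  (§6.5: "some level-1 subtensors are already missing in the input tensor because we enforced complete
  split distributions"); `starTensor₂_restrict_input` — the part of `𝒯*` inside the input is `𝒯*` with
  exactly these blocks (in the three dimensions) zeroed out.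

Everything is proved; the definitions are the ones listed; no named facts.

## References

* V. Vassilevska Williams, Y. Xu, Z. Xu, R. Zhou, *New bounds for matrix multiplication: from alpha
  to omega*, SODA 2024, arXiv:2307.07970 (held: `paper:arxiv-2307.07970`), §6.2 ("Each level-(ℓ−1)
  index sequence is partitioned into s′ parts"), §6.3 (`S_{t,i',j',k'}`), §6.5 (`𝒯*`, the two types of
  holes), §6.6. [VassilevskaWilliamsXuXuZhou2024]
-/

noncomputable section

open scoped BigOperators
open Finset

namespace Literature.Computability.AlgebraicComplexity

open Literature.Barriers.MatrixMultiplication (bigCwTensor)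

universe u

/-! ## Half-chunk positions -/

section Positions

variable {α : Type*} {c n s : ℕ}

/-- The chunk of a half-chunk position (`u` and `n + u` both belong to chunk `u`). [cite: VassilevskaWilliamsXuXuZhou2024, §6.2] -/
def chunkOf : Fin (n + n) → Fin n := fun p => Fin.addCases (motive := fun _ => Fin n) (fun u => u) (fun u => u) p

/-- Left halves. [folklore] -/
@[simp] theorem chunkOf_castAdd (u : Fin n) : chunkOf (Fin.castAdd n u) = u :=
  Fin.addCases_left (motive := fun _ => Fin n) u

/-- Right halves. [folklore] -/
@[simp] theorem chunkOf_natAdd (u : Fin n) : chunkOf (Fin.natAdd n u) = u :=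
  Fin.addCases_right (motive := fun _ => Fin n) u

/-- The chunk of a left position. [folklore] -/
theorem chunkOf_of_lt (p : Fin (n + n)) (h : (p : ℕ) < n) : chunkOf p = ⟨p, h⟩ := by
  have := chunkOf_castAdd (⟨p, h⟩ : Fin n)
  rwa [show Fin.castAdd n (⟨p, h⟩ : Fin n) = p from Fin.ext rfl] at this

/-- The chunk of a right position. [folklore] -/
theorem chunkOf_of_ge (p : Fin (n + n)) (h : n ≤ (p : ℕ)) : chunkOf p = ⟨(p : ℕ) - n, by have := p.isLt; omega⟩ := by
  have := chunkOf_natAdd (⟨(p : ℕ) - n, by have := p.isLt; omega⟩ : Fin n)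
  rwa [show Fin.natAdd n (⟨(p : ℕ) - n, by have := p.isLt; omega⟩ : Fin n) = p from Fin.ext (by simp; omega)] at this

/-- The level-`ℓ` term of a half-chunk position. [cite: VassilevskaWilliamsXuXuZhou2024, §6.2 ("the t-th part is a length-(2n_t) sequence")] -/
def halfTermOf (τ : Fin n → Fin s) : Fin (n + n) → Fin s := fun p => τ (chunkOf p)

/-- Left halves of term `t`. [folklore] -/
@[simp] theorem halfTermOf_castAdd (τ : Fin n → Fin s) (u : Fin n) : halfTermOf τ (Fin.castAdd n u) = τ u := by
  rw [halfTermOf, chunkOf_castAdd]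

/-- Right halves of term `t`. [folklore] -/
@[simp] theorem halfTermOf_natAdd (τ : Fin n → Fin s) (u : Fin n) : halfTermOf τ (Fin.natAdd n u) = τ u := by
  rw [halfTermOf, chunkOf_natAdd]

/-- **Merging level-1 sequences on half-chunks into level-1 sequences on chunks** (the inverse
re-indexing of `LevelDescent.halfChunks`, on shapes). [folklore] -/
abbrev mergeSeq (I : Fin (n + n) → Fin c → α) : Fin n → Fin (c + c) → α := mergeHalves I

/-- Level-1 sequences commute with merging. [folklore] -/
theorem levelSeq_mergeHalves {q : ℕ} (x : Fin (n + n) → Fin c → Fin (q + 2)) :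
    levelSeq (mergeHalves x) = mergeHalves (levelSeq x) := by
  have h := levelSeq_halfChunks (q := q) (mergeHalves x)
  rw [halfChunks_mergeHalves] at h
  -- `levelSeq x = halfChunks (levelSeq (mergeHalves x))`; merge both sides
  have := congrArg mergeHalves h
  rw [mergeHalves_halfChunks] at this
  exact this.symm

/-- The chunk shape of a merged sequence is the concatenation of the two half shapes. [folklore] -/
theorem mergeHalves_apply (I : Fin (n + n) → Fin c → α) (u : Fin n) :
    mergeHalves I u = Fin.append (I (Fin.castAdd n u)) (I (Fin.natAdd n u)) := rfl

end Positions

/-! ## Inside the level-`ℓ` blocks -/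

section Inside

variable {c n s : ℕ} (τ : Fin n → Fin s) (L : Fin s → InterfaceTerm (c + c))

/-- A level-`(ℓ−1)` `X`-block lies inside the level-`ℓ` `X`-blocks of the parameter list: the two
half levels of every chunk add up to `i_{τu}`. [cite: VassilevskaWilliamsXuXuZhou2024, §6 (preamble: "each level-ℓ index i_t splits into two level-(ℓ−1) indices")] -/
def InsideX (I : Fin (n + n) → Fin (2 * c + 1)) : Prop := ∀ u, (I (Fin.castAdd n u) : ℕ) + I (Fin.natAdd n u) = (L (τ u)).i

/-- The same for `Y`. [cite: VassilevskaWilliamsXuXuZhou2024, §6 (preamble)] -/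
def InsideY (J : Fin (n + n) → Fin (2 * c + 1)) : Prop := ∀ u, (J (Fin.castAdd n u) : ℕ) + J (Fin.natAdd n u) = (L (τ u)).j

/-- The same for `Z`. [cite: VassilevskaWilliamsXuXuZhou2024, §6 (preamble)] -/
def InsideZ (K : Fin (n + n) → Fin (2 * c + 1)) : Prop := ∀ u, (K (Fin.castAdd n u) : ℕ) + K (Fin.natAdd n u) = (L (τ u)).k

/-- **Blocks of admissible level-`ℓ` variables are inside**: if the merged level-1 sequence of `x'` is a
level-1 `X`-block of `𝒯_{τ,L,ε}` then the level-`(ℓ−1)` block of `x'` is inside. [cite: VassilevskaWilliamsXuXuZhou2024, §6.2] -/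
theorem insideX_of_mem_levelBlocksX {ε : ℝ} {Ih : Fin (n + n) → Fin c → Fin 3}
    (h : mergeHalves Ih ∈ levelBlocksX τ L ε) : InsideX τ L (blockOfSeq Ih) := by
  intro u
  have hl := (mem_admissibleSeqs.1 h).1 u
  rw [mergeHalves_apply, patternLevel_eq_add, leftHalf_append, rightHalf_append] at hl
  simpa using hl

/-- The same for `Y`. [cite: VassilevskaWilliamsXuXuZhou2024, §6.2] -/
theorem insideY_of_mem_levelBlocksY {ε : ℝ} {Jh : Fin (n + n) → Fin c → Fin 3}
    (h : mergeHalves Jh ∈ levelBlocksY τ L ε) : InsideY τ L (blockOfSeq Jh) := by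
  intro u
  have hl := (mem_admissibleSeqs.1 h).1 u
  rw [mergeHalves_apply, patternLevel_eq_add, leftHalf_append, rightHalf_append] at hl
  simpa using hl

/-- The same for `Z`. [cite: VassilevskaWilliamsXuXuZhou2024, §6.2] -/
theorem insideZ_of_mem_levelBlocksZ {ε : ℝ} {Kh : Fin (n + n) → Fin c → Fin 3}
    (h : mergeHalves Kh ∈ levelBlocksZ τ L ε) : InsideZ τ L (blockOfSeq Kh) := by
  intro u
  have hl := (mem_admissibleSeqs.1 h).1 u
  rw [mergeHalves_apply, patternLevel_eq_add, leftHalf_append, rightHalf_append] at hl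
  simpa using hl

/-- For an inside block, the right half level is determined by the left one. [cite: VassilevskaWilliamsXuXuZhou2024, §6 (preamble: (l_X, i_t − l_X))] -/
theorem InsideX.right_eq {I : Fin (n + n) → Fin (2 * c + 1)} (h : InsideX τ L I) (u : Fin n) :
    (I (Fin.natAdd n u) : ℕ) = (L (τ u)).i - I (Fin.castAdd n u) := by
  have := h u; omega

end Inside

/-! ## The pair term map, the classes `S_{t,i',j',k'}` and the tensor `𝒯*` -/

section PairTerms

variable {c n s : ℕ} (τ : Fin n → Fin s)

/-- **The pair term map** of a level-`(ℓ−1)` block triple on the half-chunks: position `p` goes to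
(its level-`ℓ` term, its level-`(ℓ−1)` constituent triple). [cite: VassilevskaWilliamsXuXuZhou2024, §6.3 (S_{t,i',j',k'}) and §6.5 (𝒯*)] -/
def pairTermMap {I J K : Fin (n + n) → ℕ} (h : IsLevelTriple c I J K) : Fin (n + n) → Fin s × Fin (constituentTriples c).card :=
  fun p => (halfTermOf τ p, tripleTermMap h p)

/-- The pair term map with a linear term index. [cite: VassilevskaWilliamsXuXuZhou2024, §6.5] -/
def pairTermIdx {I J K : Fin (n + n) → ℕ} (h : IsLevelTriple c I J K) : Fin (n + n) → Fin (s * (constituentTriples c).card) :=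
  fun p => finProdFinEquiv (pairTermMap τ h p)

/-- **The class `S_{t,i',j',k'}`**: the half-chunk positions of term `t` with level-`(ℓ−1)` triple
`(i',j',k')`. [cite: VassilevskaWilliamsXuXuZhou2024, §6.3 (definition of S_{t,i',j',k'})] -/
def pairClass (I J K : Fin (n + n) → ℕ) (t : Fin s) (i j k : ℕ) : Finset (Fin (n + n)) :=
  univ.filter fun p => halfTermOf τ p = t ∧ I p = i ∧ J p = j ∧ K p = k

/-- Membership in a class. [cite: VassilevskaWilliamsXuXuZhou2024, §6.3] -/
@[simp] theorem mem_pairClass {I J K : Fin (n + n) → ℕ} {t : Fin s} {i j k : ℕ} {p : Fin (n + n)} :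
    p ∈ pairClass τ I J K t i j k ↔ halfTermOf τ p = t ∧ I p = i ∧ J p = j ∧ K p = k := by
  simp [pairClass]

/-- **The fibres of the pair term map are the classes** `S_{t,i',j',k'}`. [cite: VassilevskaWilliamsXuXuZhou2024, §6.3 and §6.5] -/
theorem filter_pairTermIdx_eq {I J K : Fin (n + n) → ℕ} (h : IsLevelTriple c I J K) (t : Fin s) (sidx : Fin (constituentTriples c).card) :
    (univ.filter fun p => pairTermIdx τ h p = finProdFinEquiv (t, sidx)) =
      pairClass τ I J K t ((constituentTriples c).equivFin.symm sidx).1.1 ((constituentTriples c).equivFin.symm sidx).1.2.1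
        ((constituentTriples c).equivFin.symm sidx).1.2.2 := by
  ext p
  rw [mem_filter, mem_pairClass]
  simp only [mem_univ, true_and, pairTermIdx, EmbeddingLike.apply_eq_iff_eq, pairTermMap, Prod.mk.injEq]
  have htm : tripleTermMap h p = sidx ↔ I p = ((constituentTriples c).equivFin.symm sidx).1.1 ∧
      J p = ((constituentTriples c).equivFin.symm sidx).1.2.1 ∧ K p = ((constituentTriples c).equivFin.symm sidx).1.2.2 := by
    have := Finset.ext_iff.1 (filter_tripleTermMap_eq h sidx) p
    simpa using this
  rw [htm]

variable (c s)

/-- **The parameter list of `𝒯*`**: the term `(t, (i',j',k'))` has the constituent tensor `T_{i',j',k'}`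
and the level-`(ℓ−1)` split distributions `β_{X,t,i',j',k'}, β_{Y,…}, β_{Z,…}`. [cite: VassilevskaWilliamsXuXuZhou2024, §6.5 (𝒯*) and Prop. 6.2 (parameter list)] -/
def pairTermList (βX βY βZ : Fin s → ℕ × ℕ × ℕ → (Fin c → Fin 3) → ℝ) :
    Fin (s * (constituentTriples c).card) → InterfaceTerm c := fun idx =>
  let ti := finProdFinEquiv.symm idx
  let ijk : ℕ × ℕ × ℕ := ((constituentTriples c).equivFin.symm ti.2).1
  ⟨ijk.1, ijk.2.1, ijk.2.2, βX ti.1 ijk, βY ti.1 ijk, βZ ti.1 ijk⟩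

variable {c s}

/-- The term data at the index of `(t, (i',j',k'))`. [folklore] -/
theorem pairTermList_apply (βX βY βZ : Fin s → ℕ × ℕ × ℕ → (Fin c → Fin 3) → ℝ) (t : Fin s) (sidx : Fin (constituentTriples c).card) :
    pairTermList c s βX βY βZ (finProdFinEquiv (t, sidx)) =
      ⟨((constituentTriples c).equivFin.symm sidx).1.1, ((constituentTriples c).equivFin.symm sidx).1.2.1,
        ((constituentTriples c).equivFin.symm sidx).1.2.2, βX t ((constituentTriples c).equivFin.symm sidx).1,
        βY t ((constituentTriples c).equivFin.symm sidx).1, βZ t ((constituentTriples c).equivFin.symm sidx).1⟩ := by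
  simp [pairTermList]

variable (R : Type u) [CommSemiring R] (q : ℕ)

/-- **`𝒯*` of the constituent stage** over the level-`(ℓ−1)` block triple `(I, J, K)`: the exact
level-`(ℓ−1)` interface tensor with the pair term map and the split distributions `β` (§6.5:
"Ideally, we want the subtensor of `𝒯'''` over each triple `X_I Y_J Z_K` to be isomorphic to `𝒯*`").
[cite: VassilevskaWilliamsXuXuZhou2024, §6.5 (𝒯*)] -/
def starTensor₂ {I J K : Fin (n + n) → ℕ} (h : IsLevelTriple c I J K) (βX βY βZ : Fin s → ℕ × ℕ × ℕ → (Fin c → Fin 3) → ℝ) :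
    (Fin (n + n) → Fin c → Fin (q + 2)) → (Fin (n + n) → Fin c → Fin (q + 2)) → (Fin (n + n) → Fin c → Fin (q + 2)) → R :=
  interfaceTensor R q (pairTermIdx τ h) (pairTermList c s βX βY βZ) 0

/-- `𝒯*` is below the power on the half-chunks. [cite: VassilevskaWilliamsXuXuZhou2024, §6.5] -/
theorem tensorRestrictsTo_starTensor₂ {I J K : Fin (n + n) → ℕ} (h : IsLevelTriple c I J K)
    (βX βY βZ : Fin s → ℕ × ℕ × ℕ → (Fin c → Fin 3) → ℝ) :
    TensorRestrictsTo (kroneckerPow (kroneckerPow (bigCwTensor R q) c) (n + n)) (starTensor₂ τ R q h βX βY βZ) :=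
  tensorRestrictsTo_interfaceTensor R q _ _ _

end PairTerms

/-! ## Left classes and class sizes -/

section LeftClasses

variable {c n s : ℕ} (τ : Fin n → Fin s) (L : Fin s → InterfaceTerm (c + c))

/-- **The chunks of term `t` whose LEFT half has level-`(ℓ−1)` triple `(i',j',k')`** (the chunks "where
`(i_t, j_t, k_t)` is split into `(i',j',k')` and `(i_t − i', j_t − j', k_t − k')`").
[cite: VassilevskaWilliamsXuXuZhou2024, §6.6 ("there are A_{t,1} · α_t(i',j',k') · n_t such positions")] -/
def leftClass (I J K : Fin (n + n) → ℕ) (t : Fin s) (i j k : ℕ) : Finset (Fin n) :=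
  univ.filter fun u => τ u = t ∧ I (Fin.castAdd n u) = i ∧ J (Fin.castAdd n u) = j ∧ K (Fin.castAdd n u) = k

/-- Membership. [folklore] -/
@[simp] theorem mem_leftClass {I J K : Fin (n + n) → ℕ} {t : Fin s} {i j k : ℕ} {u : Fin n} :
    u ∈ leftClass τ I J K t i j k ↔ τ u = t ∧ I (Fin.castAdd n u) = i ∧ J (Fin.castAdd n u) = j ∧ K (Fin.castAdd n u) = k := by
  simp [leftClass]

/-- **`{α_t}`-consistency** of a level-`(ℓ−1)` block triple: for every term and split type, the number
of chunks whose left half has that split type is the prescribed count (`= A_{t,1} α_t(i',j',k') n_t`).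
[cite: VassilevskaWilliamsXuXuZhou2024, §6.2 ("block triples that are consistent with {α_t}")] -/
def IsAlphaTConsistent (cnt : Fin s → ℕ × ℕ × ℕ → ℕ) (I J K : Fin (n + n) → ℕ) : Prop :=
  ∀ t ijk, (leftClass τ I J K t ijk.1 ijk.2.1 ijk.2.2).card = cnt t ijk

/-- **Class sizes**: for a triple inside the level-`ℓ` blocks,
`S_{t,i',j',k'}` = (left halves of the chunks of left type `(i',j',k')`) ⊔ (right halves of the chunks of
left type `(i_t − i', j_t − j', k_t − k')`), so
`|S_{t,i',j',k'}| = #left(t,(i',j',k')) + #left(t,(i_t−i',j_t−j',k_t−k'))` when `(i',j',k') ≤ (i_t,j_t,k_t)`.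
[cite: VassilevskaWilliamsXuXuZhou2024, §6.6 ("A_{t,1} · (α_t(i',j',k') + α_t(i_t−i',j_t−j',k_t−k')) · n_t level-(ℓ−1) positions")] -/
theorem card_pairClass_eq {I J K : Fin (n + n) → Fin (2 * c + 1)} (hI : InsideX τ L I) (hJ : InsideY τ L J) (hK : InsideZ τ L K)
    (t : Fin s) {i j k : ℕ} (hi : i ≤ (L t).i) (hj : j ≤ (L t).j) (hk : k ≤ (L t).k) :
    (pairClass τ (seqVal I) (seqVal J) (seqVal K) t i j k).card =
      (leftClass τ (seqVal I) (seqVal J) (seqVal K) t i j k).card +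
        (leftClass τ (seqVal I) (seqVal J) (seqVal K) t ((L t).i - i) ((L t).j - j) ((L t).k - k)).card := by
  -- split the class into left and right halves
  rw [← Finset.card_filter_add_card_filter_not (p := fun p : Fin (n + n) => (p : ℕ) < n)]
  congr 1
  · -- left halves ↔ chunks of left type `(i,j,k)`
    refine card_bij (fun p hp => ⟨p, (mem_filter.1 hp).2⟩) (fun p hp => ?_) (fun p₁ _ p₂ _ h => Fin.ext (by simpa using congrArg Fin.val h))
      (fun u hu => ⟨Fin.castAdd n u, ?_, by ext; simp⟩)
    · rw [mem_filter, mem_pairClass] at hp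
      obtain ⟨⟨ht, h1, h2, h3⟩, hlt⟩ := hp
      have hp' : Fin.castAdd n (⟨p, hlt⟩ : Fin n) = p := Fin.ext rfl
      rw [mem_leftClass, hp']
      refine ⟨?_, h1, h2, h3⟩
      have hτ : τ ⟨p, hlt⟩ = halfTermOf τ p := by rw [halfTermOf, chunkOf_of_lt p hlt]
      exact hτ.trans ht
    · rw [mem_leftClass] at hu
      rw [mem_filter, mem_pairClass, halfTermOf_castAdd]
      exact ⟨⟨hu.1, hu.2.1, hu.2.2.1, hu.2.2.2⟩, by simp⟩
  · -- right halves ↔ chunks of left type `(i_t − i, j_t − j, k_t − k)`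
    refine card_bij (fun p hp => ⟨(p : ℕ) - n, by have := p.isLt; have := (mem_filter.1 hp).2; omega⟩) (fun p hp => ?_)
      (fun p₁ hp₁ p₂ hp₂ h => ?_) (fun u hu => ⟨Fin.natAdd n u, ?_, by ext; simp⟩)
    · rw [mem_filter, mem_pairClass] at hp
      obtain ⟨⟨ht, h1, h2, h3⟩, hge⟩ := hp
      rw [not_lt] at hge
      have hp' : Fin.natAdd n (⟨(p : ℕ) - n, by have := p.isLt; omega⟩ : Fin n) = p := Fin.ext (by simp; omega)
      set u : Fin n := ⟨(p : ℕ) - n, by have := p.isLt; omega⟩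
      have htu : τ u = t := by rw [← ht, halfTermOf, chunkOf_of_ge p hge]
      rw [mem_leftClass]
      refine ⟨htu, ?_, ?_, ?_⟩
      · have := hI u; rw [hp', htu] at this; simp only [seqVal] at h1 ⊢; omega
      · have := hJ u; rw [hp', htu] at this; simp only [seqVal] at h2 ⊢; omega
      · have := hK u; rw [hp', htu] at this; simp only [seqVal] at h3 ⊢; omega
    · have h₁ := (mem_filter.1 hp₁).2
      have h₂ := (mem_filter.1 hp₂).2
      rw [not_lt] at h₁ h₂
      apply Fin.ext
      have := congrArg Fin.val h
      simp only at this
      omega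
    · rw [mem_leftClass] at hu
      obtain ⟨htu, h1, h2, h3⟩ := hu
      rw [mem_filter, mem_pairClass, halfTermOf_natAdd]
      refine ⟨⟨htu, ?_, ?_, ?_⟩, by simp⟩
      · have := hI u; rw [htu] at this; simp only [seqVal] at h1 ⊢; omega
      · have := hJ u; rw [htu] at this; simp only [seqVal] at h2 ⊢; omega
      · have := hK u; rw [htu] at this; simp only [seqVal] at h3 ⊢; omega

end LeftClasses

/-! ## Holes of the first type -/

section FirstTypeHoles

variable (R : Type u) [CommSemiring R] (q : ℕ) {c n s : ℕ} (τ : Fin n → Fin s) (L : Fin s → InterfaceTerm (c + c)) (ε : ℝ)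

/-- **The holes of the first type in the `X`-dimension**: level-1 `X`-blocks of `𝒯*` whose merged
sequence is not an `ε`-admissible level-1 `X`-block of the input `𝒯_{τ,L,ε}` ("level-1 subtensors …
missing in the input tensor because we enforced complete split distributions `β_{X,t}, β_{Y,t}, β_{Z,t}`
on it"). [cite: VassilevskaWilliamsXuXuZhou2024, §6.5 (the first type of holes)] -/
def firstTypeHolesX {I J K : Fin (n + n) → ℕ} (h : IsLevelTriple c I J K) (βX βY βZ : Fin s → ℕ × ℕ × ℕ → (Fin c → Fin 3) → ℝ) :
    Finset (Fin (n + n) → Fin c → Fin 3) :=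
  (levelBlocksX (pairTermIdx τ h) (pairTermList c s βX βY βZ) 0).filter fun Ih => mergeHalves Ih ∉ levelBlocksX τ L ε

/-- The same in the `Y`-dimension. [cite: VassilevskaWilliamsXuXuZhou2024, §6.5] -/
def firstTypeHolesY {I J K : Fin (n + n) → ℕ} (h : IsLevelTriple c I J K) (βX βY βZ : Fin s → ℕ × ℕ × ℕ → (Fin c → Fin 3) → ℝ) :
    Finset (Fin (n + n) → Fin c → Fin 3) :=
  (levelBlocksY (pairTermIdx τ h) (pairTermList c s βX βY βZ) 0).filter fun Jh => mergeHalves Jh ∉ levelBlocksY τ L ε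

/-- The same in the `Z`-dimension. [cite: VassilevskaWilliamsXuXuZhou2024, §6.5] -/
def firstTypeHolesZ {I J K : Fin (n + n) → ℕ} (h : IsLevelTriple c I J K) (βX βY βZ : Fin s → ℕ × ℕ × ℕ → (Fin c → Fin 3) → ℝ) :
    Finset (Fin (n + n) → Fin c → Fin 3) :=
  (levelBlocksZ (pairTermIdx τ h) (pairTermList c s βX βY βZ) 0).filter fun Kh => mergeHalves Kh ∉ levelBlocksZ τ L ε

/-- **The input read on half-chunks**: `𝒯_{τ,L,ε}` composed with merging. [cite: VassilevskaWilliamsXuXuZhou2024, §6.2] -/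
def inputOnHalves : (Fin (n + n) → Fin c → Fin (q + 2)) → (Fin (n + n) → Fin c → Fin (q + 2)) → (Fin (n + n) → Fin c → Fin (q + 2)) → R :=
  fun x y z => interfaceTensor R q τ L ε (mergeHalves x) (mergeHalves y) (mergeHalves z)

/-- `𝒯_{τ,L,ε} ≥` its reading on half-chunks (indeed isomorphic, a re-indexing). [folklore] -/
theorem tensorRestrictsTo_inputOnHalves :
    TensorRestrictsTo (interfaceTensor R q τ L ε) (inputOnHalves R q τ L ε) :=
  TensorRestrictsTo.comap _ _ _ _

/-- Conversely. [folklore] -/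
theorem inputOnHalves_restrictsTo_input :
    TensorRestrictsTo (inputOnHalves R q τ L ε) (interfaceTensor R q τ L ε) := by
  have e : interfaceTensor R q τ L ε = fun x y z => inputOnHalves R q τ L ε (halfChunks x) (halfChunks y) (halfChunks z) := by
    funext x y z; simp [inputOnHalves]
  rw [e]
  exact TensorRestrictsTo.comap _ _ _ _

/-- **The part of `𝒯*` inside the input is `𝒯*` with the first-type holes zeroed out** (entrywise: the
entries of `𝒯*` and of the input agree on commonly supported variables, both being the power). [cite: VassilevskaWilliamsXuXuZhou2024, §6.5 (the first type of holes)] -/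
theorem starTensor₂_restrict_input {I J K : Fin (n + n) → ℕ} (h : IsLevelTriple c I J K)
    (βX βY βZ : Fin s → ℕ × ℕ × ℕ → (Fin c → Fin 3) → ℝ) (x y z : Fin (n + n) → Fin c → Fin (q + 2)) :
    partSubtensor levelSeq levelSeq levelSeq (starTensor₂ τ R q h βX βY βZ)
        (firstTypeHolesX τ L ε h βX βY βZ)ᶜ (firstTypeHolesY τ L ε h βX βY βZ)ᶜ (firstTypeHolesZ τ L ε h βX βY βZ)ᶜ x y z =
      (if levelSeq (mergeHalves x) ∈ levelBlocksX τ L ε ∧ levelSeq (mergeHalves y) ∈ levelBlocksY τ L ε ∧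
          levelSeq (mergeHalves z) ∈ levelBlocksZ τ L ε then starTensor₂ τ R q h βX βY βZ x y z else 0) := by
  classical
  rw [partSubtensor_apply]
  simp only [firstTypeHolesX, firstTypeHolesY, firstTypeHolesZ, mem_compl, mem_filter, not_and, not_not, levelSeq_mergeHalves]
  by_cases hsupp : levelSeq x ∈ levelBlocksX (pairTermIdx τ h) (pairTermList c s βX βY βZ) 0 ∧
      levelSeq y ∈ levelBlocksY (pairTermIdx τ h) (pairTermList c s βX βY βZ) 0 ∧
      levelSeq z ∈ levelBlocksZ (pairTermIdx τ h) (pairTermList c s βX βY βZ) 0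
  · obtain ⟨hx, hy, hz⟩ := hsupp
    simp only [hx, hy, hz, forall_true_left]
  · -- outside the blocks of `𝒯*` both sides vanish
    have h0 : starTensor₂ τ R q h βX βY βZ x y z = 0 := by
      rw [starTensor₂, interfaceTensor_apply, if_neg hsupp]
    rw [h0]; simp

end FirstTypeHoles

end Literature.Computability.AlgebraicComplexity
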